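import Literature.NumberTheory.Transcendental.CurvePeriodsPathConnectedProofs
import Literature.NumberTheory.Transcendental.CurvePeriodsVertexAdjustProofs
import Literature.NumberTheory.Transcendental.CurvePeriodsGridProofs
import HarnessLib

/-!
# Periods of curve type: continuously homotopic paths have the same symbol

Companion of `Literature/NumberTheory/Transcendental/CurvePeriods.lean` (Huber–Wüstholz 2022,
Thm. 13.3 (2), rendered on explicit period symbols `(Z, ω, γ)` with the elementary relations
(R1)–(R5); the general statement is the named fact `HuberWustholzCurvePeriods`). The rendering
imposes on paths only the boundaries (R5) of `C¹` triangles with ALGEBRAIC vertices, whereas in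
the book the third slot of a symbol is a class of relative SINGULAR homology, i.e. of continuous
chains modulo continuous boundaries (§3.3.1). This file proves the comparison statement for
paths on an arbitrary embedded smooth affine curve `Z` over `ℚ̄`:

* `span_single_sub_single_of_continuousHomotopy` — **two `C¹` paths on `Z` with algebraic end
  points which are homotopic with fixed end points through a merely CONTINUOUS homotopy
  `H : [0,1]² → Z(ℂ)` have the same symbol modulo the elementary relations**, for every form.

The proof cuts the square into an `N × N` grid of cells each mapped by `H` into one holomorphic
chart of `Z` (`exists_grid_charts`: charts of `CurvePeriodsChartsProofs.lean`, Lebesgue number),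
replaces every vertex `H(p/N, q/N)` by a nearby ALGEBRAIC point of `Z`
(`CurvePeriodsAlgebraicPointsProofs.lean`) — on the two sides `s = 0, 1` by moving the given paths
through such points (`exists_adjust_grid`, from `CurvePeriodsVertexAdjustProofs.lean`) — and every
edge by a `C¹` path between the new vertices inside the charts of the adjacent cells
(`exists_curvePath_subset`, `CurvePeriodsPathConnectedProofs.lean`); each cell then contributes
the cell relation of `CurvePeriodsChartPathsProofs.lean`, and the relations telescope to
`(γ₀) − (γ₁)` (`CurvePeriodsGridProofs.lean`).

## References

* A. Huber, G. Wüstholz, *Transcendence and Linear Relations of 1-Periods*, Cambridge Tracts in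
  Mathematics 227, CUP 2022 [HuberWustholz2022]: §3.3.1 (pp. 42–44 of the held text: relative
  singular homology, smooth representatives, homotopy), Thm. 13.3 (2) (p. 121).
-/

noncomputable section

open scoped BigOperators Topology
open MvPolynomial Set Filter Metric Finset

namespace Literature.NumberTheory.Transcendental

namespace CurvePeriods

set_option quotPrecheck false in
/-- Membership in the `ℚ̄`-span of the elementary relations, in the format of the conclusion of
`HuberWustholzCurvePeriods`. -/
local notation "InSpan" c:max => ∃ (k : ℕ) (ρ : Fin k → (PeriodSymbol →₀ ℂ)) (a : Fin k → ℂ),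
  (∀ l, IsElementaryRelation (ρ l)) ∧ (∀ l, IsAlgebraic ℚ (a l)) ∧ c = ∑ l, a l • ρ l

variable {Z : CurveData}

/-! ### A grid of cells each mapped into one chart -/

/-- The closed cell `[p/N, (p+1)/N] × [q/N, (q+1)/N]`. [folklore] -/
def gridCell (N p q : ℕ) : Set (ℝ × ℝ) :=
  Icc ((p : ℝ) / N) ((p + 1 : ℝ) / N) ×ˢ Icc ((q : ℝ) / N) ((q + 1 : ℝ) / N)

/-- A cell with `p, q < N` lies in the unit square. [folklore] -/
theorem gridCell_subset_square {N p q : ℕ} (hN : 0 < N) (hp : p < N) (hq : q < N) :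
    gridCell N p q ⊆ Icc (0 : ℝ) 1 ×ˢ Icc (0 : ℝ) 1 := by
  have hN' : (0 : ℝ) < N := by exact_mod_cast hN
  have hp' : (p : ℝ) + 1 ≤ N := by exact_mod_cast hp
  have hq' : (q : ℝ) + 1 ≤ N := by exact_mod_cast hq
  rintro ⟨s, t⟩ ⟨⟨hs1, hs2⟩, ⟨ht1, ht2⟩⟩
  refine ⟨⟨le_trans (by positivity) hs1, hs2.trans ((div_le_one hN').mpr hp')⟩,
    ⟨le_trans (by positivity) ht1, ht2.trans ((div_le_one hN').mpr hq')⟩⟩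

/-- Points of a cell are within `1/N` of its lower-left corner (sup distance). [folklore] -/
theorem dist_le_of_mem_gridCell {N p q : ℕ} (hN : 0 < N) {x : ℝ × ℝ} (hx : x ∈ gridCell N p q) :
    dist x ((p : ℝ) / N, (q : ℝ) / N) ≤ 1 / N := by
  have hN' : (0 : ℝ) < N := by exact_mod_cast hN
  obtain ⟨⟨hs1, hs2⟩, ⟨ht1, ht2⟩⟩ := hx
  rw [Prod.dist_eq, max_le_iff, Real.dist_eq, Real.dist_eq, abs_le, abs_le]
  refine ⟨⟨by linarith [show (0:ℝ) < 1 / N by positivity], ?_⟩,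
    ⟨by linarith [show (0:ℝ) < 1 / N by positivity], ?_⟩⟩
  · have : x.1 ≤ (p : ℝ) / N + 1 / N := by rw [← add_div]; exact hs2
    linarith
  · have : x.2 ≤ (q : ℝ) / N + 1 / N := by rw [← add_div]; exact ht2
    linarith

/-- **A grid subordinate to the charts.** For a continuous map `H` of the unit square into `Z(ℂ)`
there are `N ≥ 1` and, for every cell `(p, q)`, `p, q < N`, a holomorphic chart
`(ι, ε, Ω, ψ)` of `Z` (`exists_localChart`) with `H(cell) ⊆ Ω` (Lebesgue number of the cover of
the square by the preimages of chart domains). [folklore] -/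
theorem exists_grid_charts (hZ : Z.IsSmoothAffineCurve) {H : ℝ × ℝ → (Fin Z.n → ℂ)}
    (hH : ContinuousOn H (Icc (0 : ℝ) 1 ×ˢ Icc (0 : ℝ) 1))
    (hHZ : ∀ x ∈ Icc (0 : ℝ) 1 ×ˢ Icc (0 : ℝ) 1, H x ∈ Z.points) :
    ∃ (N : ℕ) (ι : ℕ → ℕ → Fin Z.n) (cc : ℕ → ℕ → ℂ) (εc : ℕ → ℕ → ℝ)
      (Ωc : ℕ → ℕ → Set (Fin Z.n → ℂ)) (ψc : ℕ → ℕ → ℂ → (Fin Z.n → ℂ)), 0 < N ∧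
      ∀ p q, p < N → q < N → IsOpen (Ωc p q) ∧
        AnalyticOnNhd ℂ (ψc p q) (ball (cc p q) (εc p q)) ∧
        (∀ z ∈ Ωc p q, z ∈ Z.points → z (ι p q) ∈ ball (cc p q) (εc p q) ∧ ψc p q (z (ι p q)) = z) ∧
        (∀ w ∈ ball (cc p q) (εc p q), ψc p q w ∈ Ωc p q ∧ ψc p q w ∈ Z.points ∧
          ψc p q w (ι p q) = w) ∧
        (∀ x ∈ gridCell N p q, H x ∈ Ωc p q) := by
  classical
  have hK : IsCompact (Icc (0 : ℝ) 1 ×ˢ Icc (0 : ℝ) 1) := isCompact_Icc.prod isCompact_Icc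
  have h00 : ((0 : ℝ), (0 : ℝ)) ∈ Icc (0 : ℝ) 1 ×ˢ Icc (0 : ℝ) 1 :=
    ⟨⟨le_rfl, zero_le_one⟩, ⟨le_rfl, zero_le_one⟩⟩
  haveI : Nonempty (Fin Z.n) :=
    ⟨⟨0, Nat.pos_of_ne_zero (n_ne_zero_of_mem hZ (hHZ _ h00))⟩⟩
  -- charts at the points of `Z`
  have hch : ∀ z, z ∈ Z.points → ∃ (i₀ : Fin Z.n) (ε : ℝ) (Ω : Set (Fin Z.n → ℂ))
      (ψ : ℂ → (Fin Z.n → ℂ)), 0 < ε ∧ IsOpen Ω ∧ z ∈ Ω ∧ AnalyticOnNhd ℂ ψ (ball (z i₀) ε) ∧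
      (∀ z' ∈ Ω, z' ∈ Z.points → z' i₀ ∈ ball (z i₀) ε ∧ ψ (z' i₀) = z') ∧
      (∀ w ∈ ball (z i₀) ε, ψ w ∈ Ω ∧ ψ w ∈ Z.points ∧ ψ w i₀ = w) :=
    fun z hz => hZ.exists_localChart hz
  choose! i₀ ε Ω ψ hε hΩo hzΩ hψ h1 h2 using hch
  -- the open cover of the square by preimages of chart domains, and a Lebesgue number
  have hcov : ∀ s : ↥(Icc (0 : ℝ) 1 ×ˢ Icc (0 : ℝ) 1), ∃ U : Set (ℝ × ℝ), IsOpen U ∧ (s : ℝ × ℝ) ∈ U ∧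
      ∀ x ∈ U, x ∈ Icc (0 : ℝ) 1 ×ˢ Icc (0 : ℝ) 1 → H x ∈ Ω (H s) := by
    intro s
    have hs : H s ∈ Z.points := hHZ s s.2
    obtain ⟨U, hUo, hU⟩ := (_root_.continuousOn_iff'.mp hH) (Ω (H s)) (hΩo _ hs)
    refine ⟨U, hUo, ?_, fun x hxU hx => ?_⟩
    · have : (s : ℝ × ℝ) ∈ H ⁻¹' Ω (H s) ∩ Icc (0 : ℝ) 1 ×ˢ Icc (0 : ℝ) 1 := ⟨hzΩ _ hs, s.2⟩
      rw [hU] at this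
      exact this.1
    · have : x ∈ U ∩ Icc (0 : ℝ) 1 ×ˢ Icc (0 : ℝ) 1 := ⟨hxU, hx⟩
      rw [← hU] at this
      exact this.1
  choose U hUo hsU hU using hcov
  obtain ⟨δ, hδ, hleb⟩ := lebesgue_number_lemma_of_metric hK hUo
    (fun x hx => mem_iUnion.mpr ⟨⟨x, hx⟩, hsU ⟨x, hx⟩⟩)
  obtain ⟨N₀, hN₀⟩ := exists_nat_one_div_lt hδ
  set N : ℕ := N₀ + 1 with hN
  have hNpos : 0 < N := Nat.succ_pos N₀
  have hN' : (0 : ℝ) < N := by exact_mod_cast hNpos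
  have hNinv : 1 / (N : ℝ) < δ := by rw [hN]; exact_mod_cast hN₀
  -- the chart of cell `(p, q)`
  have hcellK : ∀ p q, p < N → q < N → ((p : ℝ) / N, (q : ℝ) / N) ∈ Icc (0 : ℝ) 1 ×ˢ Icc (0 : ℝ) 1 :=
    fun p q hp hq => gridCell_subset_square hNpos hp hq
      ⟨⟨le_rfl, div_le_div_of_nonneg_right (by linarith) hN'.le⟩,
        ⟨le_rfl, div_le_div_of_nonneg_right (by linarith) hN'.le⟩⟩
  have hidx : ∀ p q, p < N → q < N → ∃ s : ↥(Icc (0 : ℝ) 1 ×ˢ Icc (0 : ℝ) 1),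
      ∀ x ∈ gridCell N p q, H x ∈ Ω (H s) := by
    intro p q hp hq
    obtain ⟨s, hs⟩ := hleb _ (hcellK p q hp hq)
    refine ⟨s, fun x hx => hU s x (hs ?_) (gridCell_subset_square hNpos hp hq hx)⟩
    rw [mem_ball]
    exact lt_of_le_of_lt (dist_le_of_mem_gridCell hNpos hx) hNinv
  haveI : Nonempty ↥(Icc (0 : ℝ) 1 ×ˢ Icc (0 : ℝ) 1) := ⟨⟨_, h00⟩⟩
  choose! s hs using hidx
  refine ⟨N, fun p q => i₀ (H (s p q)), fun p q => H (s p q) (i₀ (H (s p q))),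
    fun p q => ε (H (s p q)), fun p q => Ω (H (s p q)), fun p q => ψ (H (s p q)), hNpos,
    fun p q hp hq => ?_⟩
  have hz : H (s p q) ∈ Z.points := hHZ _ (s p q).2
  exact ⟨hΩo _ hz, hψ _ hz, h1 _ hz, h2 _ hz, hs p q hp hq⟩

/-! ### Continuous concatenation of three paths -/

/-- Clamping to `[0,1]`. [folklore] -/
def clamp01 (t : ℝ) : ℝ := max 0 (min t 1)

/-- `clamp01` is continuous. [folklore] -/
theorem continuous_clamp01 : Continuous clamp01 :=
  continuous_const.max (continuous_id.min continuous_const)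

/-- `clamp01 t ∈ [0,1]`. [folklore] -/
theorem clamp01_mem (t : ℝ) : clamp01 t ∈ Icc (0 : ℝ) 1 :=
  ⟨le_max_left _ _, max_le zero_le_one (min_le_right _ _)⟩

/-- `clamp01 t = t` on `[0,1]`. [folklore] -/
theorem clamp01_of_mem {t : ℝ} (ht : t ∈ Icc (0 : ℝ) 1) : clamp01 t = t := by
  rw [clamp01, min_eq_left ht.2, max_eq_right ht.1]

/-- **Concatenation of three continuous paths** `f ⋆ g ⋆ k` (each run at triple speed), continuous
when the junction values agree. [folklore] -/
theorem continuous_concat3 {X : Type*} [TopologicalSpace X] {f g k : ℝ → X} (hf : Continuous f)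
    (hg : Continuous g) (hk : Continuous k) (h₁ : f 1 = g 0) (h₂ : g 1 = k 0) :
    Continuous fun t : ℝ =>
      if t ≤ 1 / 3 then f (3 * t) else if t ≤ 2 / 3 then g (3 * t - 1) else k (3 * t - 2) := by
  refine Continuous.if_le (hf.comp (continuous_const.mul continuous_id)) ?_ continuous_id
    continuous_const (fun x hx => ?_)
  · refine Continuous.if_le (hg.comp ((continuous_const.mul continuous_id).sub continuous_const))
      (hk.comp ((continuous_const.mul continuous_id).sub continuous_const)) continuous_id
      continuous_const (fun x hx => ?_)
    rw [hx]
    show g (3 * (2 / 3) - 1) = k (3 * (2 / 3) - 2)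
    norm_num [h₂]
  · rw [hx]
    show f (3 * (1 / 3)) = if (1 / 3 : ℝ) ≤ 2 / 3 then g (3 * (1 / 3) - 1) else k (3 * (1 / 3) - 2)
    rw [if_pos (by norm_num)]
    norm_num [h₁]

/-- Values of the triple concatenation lie in any set containing the values of the three pieces
on `[0,1]`. [folklore] -/
theorem concat3_mem {X : Type*} {f g k : ℝ → X} {S : Set X} (hf : ∀ t ∈ Icc (0 : ℝ) 1, f t ∈ S)
    (hg : ∀ t ∈ Icc (0 : ℝ) 1, g t ∈ S) (hk : ∀ t ∈ Icc (0 : ℝ) 1, k t ∈ S) (t : ℝ)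
    (ht : t ∈ Icc (0 : ℝ) 1) :
    (if t ≤ 1 / 3 then f (3 * t) else if t ≤ 2 / 3 then g (3 * t - 1) else k (3 * t - 2)) ∈ S := by
  split_ifs with h1 h2
  · exact hf _ ⟨by linarith [ht.1], by linarith⟩
  · exact hg _ ⟨by linarith [not_le.mp h1], by linarith⟩
  · exact hk _ ⟨by linarith [not_le.mp h2], by linarith [ht.2]⟩

/-! ### Moving a path through algebraic points at all grid parameters -/

/-- `q / N ∈ (0,1)` for `0 < q < N`. [folklore] -/
theorem div_mem_Ioo {q N : ℕ} (hq0 : 0 < q) (hq : q < N) : (q : ℝ) / N ∈ Ioo (0 : ℝ) 1 := by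
  have hN : (0 : ℝ) < N := by exact_mod_cast (hq0.trans hq)
  exact ⟨by positivity, (div_lt_one hN).mpr (by exact_mod_cast hq)⟩

/-- Distinct grid parameters are at distance `≥ 1/N`. [folklore] -/
theorem dist_div_ge {q m N : ℕ} (hN : 0 < N) (hqm : q ≠ m) :
    1 / (4 * (N : ℝ)) ≤ dist ((q : ℝ) / N) ((m : ℝ) / N) := by
  have hN' : (0 : ℝ) < N := by exact_mod_cast hN
  rw [Real.dist_eq, ← sub_div, abs_div, abs_of_pos hN']
  have h1 : (1 : ℝ) ≤ |(q : ℝ) - m| := by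
    rcases lt_or_gt_of_ne hqm with hlt | hgt
    · have : (q : ℝ) + 1 ≤ m := by exact_mod_cast hlt
      rw [abs_of_neg (by linarith)]
      linarith
    · have : (m : ℝ) + 1 ≤ q := by exact_mod_cast hgt
      rw [abs_of_pos (by linarith)]
      linarith
  rw [div_le_div_iff₀ (by positivity) hN']
  nlinarith

/-- **Moving a path through prescribed algebraic points at the grid parameters.** Let `γ` be a
`C¹` path on `Z`, `N ≥ 1`, and for every `0 < q < N` a chart `(ιv q, εv q, Ωv q, ψv q)` of `Z`
centred at `γ(q/N)` and a point `a q ∈ Z(ℂ) ∩ Ωv q` with `|a(q)_ι − γ(q/N)_ι| < εv q / 2`. Then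
there is a `C¹` path `γ′` with the same end points, `γ′(q/N) = a q` for all `0 < q < N`, every
value `γ′(t)` either equal to `γ(t)` or lying in `Ωv q` for some `q` with `|t − q/N| < 1/(4N)`,
and `(Z, ω, γ) ∼ (Z, ω, γ′)` (iterate `exists_adjust` with radius `1/(4N)`).
[cite: HuberWustholz2022, §3.3.1 (pp. 42–44)] -/
theorem exists_adjust_grid (hZ : Z.IsSmoothAffineCurve) (ω : Fin Z.n → MvPolynomial (Fin Z.n) ℂ)
    (h : ∀ i, HasAlgCoeffs (ω i)) (γ : CurvePath Z) {N : ℕ} (hN : 0 < N)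
    (ιv : ℕ → Fin Z.n) (εv : ℕ → ℝ) (Ωv : ℕ → Set (Fin Z.n → ℂ)) (ψv : ℕ → ℂ → (Fin Z.n → ℂ))
    (hψv : ∀ q, 0 < q → q < N →
      AnalyticOnNhd ℂ (ψv q) (ball (γ.toFun ((q : ℝ) / N) (ιv q)) (εv q)))
    (h1v : ∀ q, 0 < q → q < N → ∀ z ∈ Ωv q, z ∈ Z.points →
      z (ιv q) ∈ ball (γ.toFun ((q : ℝ) / N) (ιv q)) (εv q) ∧ ψv q (z (ιv q)) = z)
    (h2v : ∀ q, 0 < q → q < N → ∀ w ∈ ball (γ.toFun ((q : ℝ) / N) (ιv q)) (εv q),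
      ψv q w ∈ Ωv q ∧ ψv q w ∈ Z.points ∧ ψv q w (ιv q) = w)
    (hΩvo : ∀ q, 0 < q → q < N → IsOpen (Ωv q))
    (hγΩ : ∀ q, 0 < q → q < N → γ.toFun ((q : ℝ) / N) ∈ Ωv q)
    (a : ℕ → (Fin Z.n → ℂ)) (haZ : ∀ q, 0 < q → q < N → a q ∈ Z.points)
    (haΩ : ∀ q, 0 < q → q < N → a q ∈ Ωv q)
    (ha2 : ∀ q, 0 < q → q < N → a q (ιv q) ∈ ball (γ.toFun ((q : ℝ) / N) (ιv q)) (εv q / 2)) :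
    ∃ γ' : CurvePath Z, (∀ q, 0 < q → q < N → γ'.toFun ((q : ℝ) / N) = a q) ∧
      γ'.toFun 0 = γ.toFun 0 ∧ γ'.toFun 1 = γ.toFun 1 ∧
      (∀ t, γ'.toFun t = γ.toFun t ∨
        ∃ q, 0 < q ∧ q < N ∧ dist t ((q : ℝ) / N) < 1 / (4 * (N : ℝ)) ∧ γ'.toFun t ∈ Ωv q) ∧
      InSpan (Finsupp.single (⟨Z, hZ, ω, h, γ⟩ : PeriodSymbol) (1 : ℂ) -
        Finsupp.single ⟨Z, hZ, ω, h, γ'⟩ 1) := by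
  have hρ : (0 : ℝ) < 1 / (4 * (N : ℝ)) := by
    have : (0 : ℝ) < N := by exact_mod_cast hN
    positivity
  -- induction on the number `m` of treated parameters
  have hind : ∀ m : ℕ, ∃ γ' : CurvePath Z,
      (∀ q, 0 < q → q < m → q < N → γ'.toFun ((q : ℝ) / N) = a q) ∧
      (∀ t, (∀ q, 0 < q → q < m → q < N → 1 / (4 * (N : ℝ)) ≤ dist t ((q : ℝ) / N)) →
        γ'.toFun t = γ.toFun t) ∧
      γ'.toFun 0 = γ.toFun 0 ∧ γ'.toFun 1 = γ.toFun 1 ∧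
      (∀ t, γ'.toFun t = γ.toFun t ∨
        ∃ q, 0 < q ∧ q < N ∧ dist t ((q : ℝ) / N) < 1 / (4 * (N : ℝ)) ∧ γ'.toFun t ∈ Ωv q) ∧
      InSpan (Finsupp.single (⟨Z, hZ, ω, h, γ⟩ : PeriodSymbol) (1 : ℂ) -
        Finsupp.single ⟨Z, hZ, ω, h, γ'⟩ 1) := by
    intro m
    induction m with
    | zero =>
      refine ⟨γ, fun q _ hq _ => absurd hq (Nat.not_lt_zero q), fun t _ => rfl, rfl, rfl,
        fun t => Or.inl rfl, ?_⟩
      rw [sub_self]; exact span_zero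
    | succ m ih =>
      obtain ⟨γm, hval, hunch, h0, h1, hdisj, hspan⟩ := ih
      by_cases hm : 0 < m ∧ m < N
      · -- treat the parameter `m / N`
        have hmI : (m : ℝ) / N ∈ Ioo (0 : ℝ) 1 := div_mem_Ioo hm.1 hm.2
        have heq : γm.toFun ((m : ℝ) / N) = γ.toFun ((m : ℝ) / N) :=
          hunch _ fun q _ hqm _ => dist_div_ge hN (by omega : m ≠ q)
        have hψ' : AnalyticOnNhd ℂ (ψv m) (ball (γm.toFun ((m : ℝ) / N) (ιv m)) (εv m)) := by
          rw [heq]; exact hψv m hm.1 hm.2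
        have h1' : ∀ z ∈ Ωv m, z ∈ Z.points →
            z (ιv m) ∈ ball (γm.toFun ((m : ℝ) / N) (ιv m)) (εv m) ∧ ψv m (z (ιv m)) = z := by
          rw [heq]; exact h1v m hm.1 hm.2
        have h2' : ∀ w ∈ ball (γm.toFun ((m : ℝ) / N) (ιv m)) (εv m),
            ψv m w ∈ Ωv m ∧ ψv m w ∈ Z.points ∧ ψv m w (ιv m) = w := by
          rw [heq]; exact h2v m hm.1 hm.2
        have hγΩ' : γm.toFun ((m : ℝ) / N) ∈ Ωv m := by rw [heq]; exact hγΩ m hm.1 hm.2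
        have ha2' : a m (ιv m) ∈ ball (γm.toFun ((m : ℝ) / N) (ιv m)) (εv m / 2) := by
          rw [heq]; exact ha2 m hm.1 hm.2
        obtain ⟨γ', hγ'a, hγ'un, hγ'v, hγ'0, hγ'1, hγ'sp⟩ := exists_adjust hZ ω h γm hmI hψ' h1' h2'
          (hΩvo m hm.1 hm.2) hγΩ' (haZ m hm.1 hm.2) (haΩ m hm.1 hm.2) ha2' hρ
        refine ⟨γ', fun q hq0 hqm hqN => ?_, fun t ht => ?_, hγ'0.trans h0, hγ'1.trans h1,
          fun t => ?_, ?_⟩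
        · rcases Nat.lt_succ_iff_lt_or_eq.mp hqm with hlt | rfl
          · rw [hγ'un _ (dist_div_ge hN (by omega : q ≠ m)), hval q hq0 hlt hqN]
          · exact hγ'a
        · rw [hγ'un t (ht m hm.1 (Nat.lt_succ_self m) hm.2)]
          exact hunch t fun q hq0 hqm hqN => ht q hq0 (Nat.lt_succ_of_lt hqm) hqN
        · rcases hγ'v t with hEq | hΩ
          · rw [hEq]; exact hdisj t
          · by_cases hd : dist t ((m : ℝ) / N) < 1 / (4 * (N : ℝ))
            · exact Or.inr ⟨m, hm.1, hm.2, hd, hΩ⟩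
            · rw [hγ'un t (not_lt.mp hd)]; exact hdisj t
        · obtain ⟨k, ρ, c, hρ', hc, he⟩ := span_add hspan hγ'sp
          exact ⟨k, ρ, c, hρ', hc, by rw [← he]; abel⟩
      · -- nothing to do at this step
        refine ⟨γm, fun q hq0 hqm hqN => ?_, fun t ht => hunch t fun q hq0 hqm hqN =>
          ht q hq0 (Nat.lt_succ_of_lt hqm) hqN, h0, h1, hdisj, hspan⟩
        rcases Nat.lt_succ_iff_lt_or_eq.mp hqm with hlt | rfl
        · exact hval q hq0 hlt hqN
        · exact absurd ⟨hq0, hqN⟩ hm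
  obtain ⟨γ', hval, _, h0, h1, hdisj, hspan⟩ := hind N
  exact ⟨γ', fun q hq0 hqN => hval q hq0 hqN hqN, h0, h1, hdisj, hspan⟩

/-! ### Links and edges -/

/-- **A continuous link from a point of a chart to another** (chart-straight, clamped
parameter): used to join a vertex `H(p/N, q/N)` to the algebraic point replacing it. [folklore] -/
theorem exists_vertexLink {i₀ : Fin Z.n} {c : ℂ} {ε : ℝ} {Ω : Set (Fin Z.n → ℂ)}
    {ψ : ℂ → (Fin Z.n → ℂ)} (hψ : AnalyticOnNhd ℂ ψ (ball c ε))
    (h2 : ∀ w ∈ ball c ε, ψ w ∈ Ω ∧ ψ w ∈ Z.points ∧ ψ w i₀ = w) {a v : Fin Z.n → ℂ}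
    (ha : a i₀ ∈ ball c ε) (hv : v i₀ ∈ ball c ε) (hψa : ψ (a i₀) = a) (hψv : ψ (v i₀) = v) :
    ∃ κ : ℝ → (Fin Z.n → ℂ), Continuous κ ∧ κ 0 = a ∧ κ 1 = v ∧ (∀ t, κ t ∈ Z.points) ∧
      ∀ t, κ t ∈ Ω := by
  have hmem : ∀ t, segPoint (a i₀) (v i₀) (clamp01 t) ∈ ball c ε := fun t =>
    segPoint_mem (convex_ball c ε) ha hv (clamp01_mem t)
  refine ⟨fun t => ψ (segPoint (a i₀) (v i₀) (clamp01 t)),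
    hψ.continuousOn.comp_continuous ((contDiff_segPoint (a i₀) (v i₀) (n := 0)).continuous.comp
      continuous_clamp01) hmem, ?_, ?_, fun t => (h2 _ (hmem t)).2.1, fun t => (h2 _ (hmem t)).1⟩
  · show ψ (segPoint (a i₀) (v i₀) (clamp01 0)) = a
    rw [clamp01_of_mem ⟨le_rfl, zero_le_one⟩, segPoint_zero, hψa]
  · show ψ (segPoint (a i₀) (v i₀) (clamp01 1)) = v
    rw [clamp01_of_mem ⟨zero_le_one, le_rfl⟩, segPoint_one, hψv]

/-- **A `C¹` edge path from three continuous pieces**: a link `a → v`, a continuous path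
`v → v′` and a link `a′ → v′` (reversed), all inside `Z ∩ G`, `G` open, with `a, a′` algebraic,
give a `C¹` path on `Z` from `a` to `a′` inside `G` (`exists_curvePath_subset`). [folklore] -/
theorem exists_edgePath (hZ : Z.IsSmoothAffineCurve) {G : Set (Fin Z.n → ℂ)} (hG : IsOpen G)
    {a v v' a' : Fin Z.n → ℂ} (κ : ℝ → (Fin Z.n → ℂ)) (hκ : Continuous κ) (hκ0 : κ 0 = a)
    (hκ1 : κ 1 = v) (hκZ : ∀ t, κ t ∈ Z.points) (hκG : ∀ t, κ t ∈ G)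
    (e : ℝ → (Fin Z.n → ℂ)) (he : Continuous e) (he0 : e 0 = v) (he1 : e 1 = v')
    (heZ : ∀ t ∈ Icc (0 : ℝ) 1, e t ∈ Z.points) (heG : ∀ t ∈ Icc (0 : ℝ) 1, e t ∈ G)
    (κ' : ℝ → (Fin Z.n → ℂ)) (hκ' : Continuous κ') (hκ'0 : κ' 0 = a') (hκ'1 : κ' 1 = v')
    (hκ'Z : ∀ t, κ' t ∈ Z.points) (hκ'G : ∀ t, κ' t ∈ G)
    (ha : ∀ i, IsAlgebraic ℚ (a i)) (ha' : ∀ i, IsAlgebraic ℚ (a' i)) :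
    ∃ σ : CurvePath Z, σ.toFun 0 = a ∧ σ.toFun 1 = a' ∧ ∀ t ∈ Icc (0 : ℝ) 1, σ.toFun t ∈ G := by
  set c : ℝ → (Fin Z.n → ℂ) := fun t =>
    if t ≤ 1 / 3 then κ (3 * t) else if t ≤ 2 / 3 then e (3 * t - 1) else κ' (1 - (3 * t - 2)) with hc
  have hcont : Continuous c :=
    continuous_concat3 hκ he (hκ'.comp (continuous_const.sub continuous_id)) (by rw [hκ1, he0])
      (by show e 1 = κ' (1 - 0); rw [sub_zero, hκ'1, he1])
  have hc0 : c 0 = a := by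
    show (if (0 : ℝ) ≤ 1 / 3 then κ (3 * 0) else
      if (0 : ℝ) ≤ 2 / 3 then e (3 * 0 - 1) else κ' (1 - (3 * 0 - 2))) = a
    rw [if_pos (by norm_num), mul_zero, hκ0]
  have hc1 : c 1 = a' := by
    show (if (1 : ℝ) ≤ 1 / 3 then κ (3 * 1) else
      if (1 : ℝ) ≤ 2 / 3 then e (3 * 1 - 1) else κ' (1 - (3 * 1 - 2))) = a'
    rw [if_neg (by norm_num), if_neg (by norm_num)]
    norm_num [hκ'0]
  have hcZ : ∀ t ∈ Icc (0 : ℝ) 1, c t ∈ Z.points := fun t ht =>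
    concat3_mem (S := Z.points) (fun t _ => hκZ t) heZ (fun t _ => hκ'Z _) t ht
  have hcG : ∀ t ∈ Icc (0 : ℝ) 1, c t ∈ G := fun t ht =>
    concat3_mem (S := G) (fun t _ => hκG t) heG (fun t _ => hκ'G _) t ht
  obtain ⟨σ, h0, h1, hσ⟩ := exists_curvePath_subset hZ hG hcont.continuousOn hcZ hcG
    (by rw [hc0]; exact ha) (by rw [hc1]; exact ha')
  exact ⟨σ, h0.trans hc0, h1.trans hc1, hσ⟩

/-- **Grid pieces of an adjusted side path stay in the cell chart.** If `γ′` differs from `γ`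
only near the parameters `q'/N`, with values in `Ωv q'` there, then the `q`-th grid piece of
`γ′` lies in any set `S` containing `γ([q/N, (q+1)/N])`, `Ωv q` (if `0 < q`) and `Ωv (q+1)`
(if `q + 1 < N`). [folklore] -/
theorem gridPiece_mem_of_adjusted {γ γ' : CurvePath Z} {N : ℕ} (hN : 0 < N)
    (halg : ∀ q, q ≤ N → ∀ i, IsAlgebraic ℚ (γ'.toFun ((q : ℝ) / N) i))
    (Ωv : ℕ → Set (Fin Z.n → ℂ))
    (hdisj : ∀ t, γ'.toFun t = γ.toFun t ∨
      ∃ q, 0 < q ∧ q < N ∧ dist t ((q : ℝ) / N) < 1 / (4 * (N : ℝ)) ∧ γ'.toFun t ∈ Ωv q)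
    {S : Set (Fin Z.n → ℂ)} {q : ℕ} (hq : q < N)
    (hγS : ∀ u ∈ Icc ((q : ℝ) / N) ((q + 1 : ℝ) / N), γ.toFun u ∈ S) (hS1 : 0 < q → Ωv q ⊆ S)
    (hS2 : q + 1 < N → Ωv (q + 1) ⊆ S) :
    ∀ t ∈ Icc (0 : ℝ) 1, (γ'.gridPiece N hN halg q).toFun t ∈ S := by
  intro t ht
  have hN' : (0 : ℝ) < N := by exact_mod_cast hN
  rw [CurvePath.gridPiece_apply γ' N hN halg hq]
  set u : ℝ := (q : ℝ) / N + t / N with hu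
  have hu1 : (q : ℝ) / N ≤ u := by
    rw [hu]
    have : 0 ≤ t / N := div_nonneg ht.1 hN'.le
    linarith
  have hu2 : u ≤ ((q : ℝ) + 1) / N := by
    rw [hu, ← add_div]; exact div_le_div_of_nonneg_right (by linarith [ht.2]) hN'.le
  rcases hdisj u with hEq | ⟨q', hq'0, hq'N, hd, hmem⟩
  · rw [hEq]; exact hγS u ⟨hu1, hu2⟩
  · rw [Real.dist_eq, abs_lt] at hd
    have hquarter : 1 / (4 * (N : ℝ)) < 1 / N := by
      rw [div_lt_div_iff₀ (by positivity) hN']; linarith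
    have hle1 : q ≤ q' := by
      by_contra hlt
      have hlt' : (q' : ℝ) + 1 ≤ q := by exact_mod_cast Nat.lt_of_not_le hlt
      have : ((q' : ℝ) + 1) / N ≤ (q : ℝ) / N := div_le_div_of_nonneg_right hlt' hN'.le
      rw [add_div] at this
      linarith [hd.2]
    have hle2 : q' ≤ q + 1 := by
      by_contra hlt
      have hlt' : (q : ℝ) + 2 ≤ q' := by exact_mod_cast Nat.lt_of_not_le hlt
      have : ((q : ℝ) + 2) / N ≤ (q' : ℝ) / N := div_le_div_of_nonneg_right hlt' hN'.le
      have h2 : ((q : ℝ) + 2) / N = ((q : ℝ) + 1) / N + 1 / N := by rw [← add_div]; ring_nf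
      rw [h2] at this
      linarith [hd.1]
    rcases Nat.eq_or_lt_of_le hle1 with heq | hlt
    · subst heq; exact hS1 hq'0 hmem
    · have heq : q' = q + 1 := by omega
      subst heq; exact hS2 hq'N hmem

/-- Membership in a cell from coordinate bounds. [folklore] -/
theorem mem_gridCell_of {N p q : ℕ} (hN : 0 < N) {x y : ℝ} (hx1 : (p : ℝ) ≤ x) (hx2 : x ≤ p + 1)
    (hy1 : (q : ℝ) ≤ y) (hy2 : y ≤ q + 1) : (x / N, y / N) ∈ gridCell N p q := by
  have hN' : (0 : ℝ) < N := by exact_mod_cast hN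
  exact ⟨⟨div_le_div_of_nonneg_right hx1 hN'.le, div_le_div_of_nonneg_right hx2 hN'.le⟩,
    ⟨div_le_div_of_nonneg_right hy1 hN'.le, div_le_div_of_nonneg_right hy2 hN'.le⟩⟩

/-- `p' ≤ p ≤ p' + 1` (as reals) for `p' ∈ {p − 1, p}` (natural subtraction). [folklore] -/
theorem cast_le_and_le_of_pred_or_eq {p p' : ℕ} (h : p' = p - 1 ∨ p' = p) :
    (p' : ℝ) ≤ p ∧ (p : ℝ) ≤ p' + 1 := by
  rcases h with rfl | rfl
  · constructor
    · exact_mod_cast Nat.sub_le p 1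
    · exact_mod_cast (by omega : p ≤ p - 1 + 1)
  · constructor
    · exact le_rfl
    · linarith

/-! ### The theorem -/

/-- **Continuously homotopic paths have the same symbol.** Let `Z` be a smooth affine curve over
`ℚ̄`, `H : [0,1]² → Z(ℂ)` CONTINUOUS with `H(s, 0)` and `H(s, 1)` independent of `s`, and let
`γ₀`, `γ₁` be `C¹` paths on `Z` with algebraic end points agreeing with `H(0, ·)` and `H(1, ·)`
on `[0,1]`. Then `(Z, ω, γ₀) − (Z, ω, γ₁)` lies in the `ℚ̄`-span of the elementary relations,
for every polynomial `1`-form `ω` over `ℚ̄` (book §3.3.1: the symbol only depends on the class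
of the path in relative singular homology; here: on its homotopy class with fixed end points).
Proof: grid of cells in charts, algebraic replacement of the vertices, `C¹` replacement of the
edges, cell relations, telescoping (see the module docstring).
[cite: HuberWustholz2022, §3.3.1 (pp. 42–44), Thm. 13.3 (2) (p. 121)] -/
theorem span_single_sub_single_of_continuousHomotopy (hZ : Z.IsSmoothAffineCurve)
    (ω : Fin Z.n → MvPolynomial (Fin Z.n) ℂ) (h : ∀ i, HasAlgCoeffs (ω i))
    (H : ℝ × ℝ → (Fin Z.n → ℂ)) (hH : ContinuousOn H (Icc (0 : ℝ) 1 ×ˢ Icc (0 : ℝ) 1))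
    (hHZ : ∀ x ∈ Icc (0 : ℝ) 1 ×ˢ Icc (0 : ℝ) 1, H x ∈ Z.points)
    (hH0 : ∀ s ∈ Icc (0 : ℝ) 1, H (s, 0) = H (0, 0))
    (hH1 : ∀ s ∈ Icc (0 : ℝ) 1, H (s, 1) = H (0, 1))
    (γ₀ γ₁ : CurvePath Z) (hγ₀ : ∀ t ∈ Icc (0 : ℝ) 1, γ₀.toFun t = H (0, t))
    (hγ₁ : ∀ t ∈ Icc (0 : ℝ) 1, γ₁.toFun t = H (1, t)) :
    InSpan (Finsupp.single (⟨Z, hZ, ω, h, γ₀⟩ : PeriodSymbol) (1 : ℂ) -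
      Finsupp.single (⟨Z, hZ, ω, h, γ₁⟩ : PeriodSymbol) (1 : ℂ)) := by
  classical
  have hI0 : (0 : ℝ) ∈ Icc (0 : ℝ) 1 := ⟨le_rfl, zero_le_one⟩
  have hI1 : (1 : ℝ) ∈ Icc (0 : ℝ) 1 := ⟨zero_le_one, le_rfl⟩
  -- the end points
  set P : Fin Z.n → ℂ := H (0, 0) with hP
  set Q : Fin Z.n → ℂ := H (0, 1) with hQ
  have hP0 : γ₀.toFun 0 = P := hγ₀ 0 hI0
  have hQ0 : γ₀.toFun 1 = Q := hγ₀ 1 hI1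
  have hP1 : γ₁.toFun 0 = P := (hγ₁ 0 hI0).trans (hH0 1 hI1)
  have hQ1 : γ₁.toFun 1 = Q := (hγ₁ 1 hI1).trans (hH1 1 hI1)
  have hPZ : P ∈ Z.points := hP0 ▸ γ₀.mem_points 0 hI0
  have hQZ : Q ∈ Z.points := hQ0 ▸ γ₀.mem_points 1 hI1
  have hPa : ∀ i, IsAlgebraic ℚ (P i) := fun i => hP0 ▸ γ₀.algebraic_zero i
  have hQa : ∀ i, IsAlgebraic ℚ (Q i) := fun i => hQ0 ▸ γ₀.algebraic_one i
  ------------------------------------------------------------------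
  -- Step 1: the grid of cell charts
  ------------------------------------------------------------------
  obtain ⟨N, ι, cc, εc, Ωc, ψc, hN, hcell⟩ := exists_grid_charts hZ hH hHZ
  have hN' : (0 : ℝ) < N := by exact_mod_cast hN
  -- cell domains, extended by `univ` outside the grid
  let Ωx : ℕ → ℕ → Set (Fin Z.n → ℂ) := fun p q => if p < N ∧ q < N then Ωc p q else univ
  have hΩx_eq : ∀ p q, p < N → q < N → Ωx p q = Ωc p q := fun p q hp hq => if_pos ⟨hp, hq⟩
  have hΩxo : ∀ p q, IsOpen (Ωx p q) := by
    intro p q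
    by_cases hpq : p < N ∧ q < N
    · rw [show Ωx p q = Ωc p q from if_pos hpq]; exact (hcell p q hpq.1 hpq.2).1
    · rw [show Ωx p q = univ from if_neg hpq]; exact isOpen_univ
  have hΩxc : ∀ p q x, x ∈ gridCell N p q → x ∈ Icc (0 : ℝ) 1 ×ˢ Icc (0 : ℝ) 1 → H x ∈ Ωx p q := by
    intro p q x hx hxK
    by_cases hpq : p < N ∧ q < N
    · rw [show Ωx p q = Ωc p q from if_pos hpq]; exact (hcell p q hpq.1 hpq.2).2.2.2.2 x hx
    · rw [show Ωx p q = univ from if_neg hpq]; exact mem_univ _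
  ------------------------------------------------------------------
  -- Step 2: vertices `v p q = H(p/N, q/N)`, neighbourhoods `G p q`, vertex charts
  ------------------------------------------------------------------
  let v : ℕ → ℕ → (Fin Z.n → ℂ) := fun p q => H ((p : ℝ) / N, (q : ℝ) / N)
  let G : ℕ → ℕ → Set (Fin Z.n → ℂ) := fun p q =>
    Ωx (p - 1) (q - 1) ∩ Ωx (p - 1) q ∩ Ωx p (q - 1) ∩ Ωx p q
  have hGo : ∀ p q, IsOpen (G p q) := fun p q =>
    (((hΩxo _ _).inter (hΩxo _ _)).inter (hΩxo _ _)).inter (hΩxo _ _)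
  have hG1 : ∀ p q, G p q ⊆ Ωx (p - 1) (q - 1) := fun p q =>
    (inter_subset_left.trans inter_subset_left).trans inter_subset_left
  have hG2 : ∀ p q, G p q ⊆ Ωx (p - 1) q := fun p q =>
    (inter_subset_left.trans inter_subset_left).trans inter_subset_right
  have hG3 : ∀ p q, G p q ⊆ Ωx p (q - 1) := fun p q => inter_subset_left.trans inter_subset_right
  have hG4 : ∀ p q, G p q ⊆ Ωx p q := fun p q => inter_subset_right
  have hvK : ∀ p q, p ≤ N → q ≤ N → ((p : ℝ) / N, (q : ℝ) / N) ∈ Icc (0 : ℝ) 1 ×ˢ Icc (0 : ℝ) 1 :=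
    fun p q hp hq => ⟨div_mem_Icc hN hp, div_mem_Icc hN hq⟩
  have hvZ : ∀ p q, p ≤ N → q ≤ N → v p q ∈ Z.points := fun p q hp hq => hHZ _ (hvK p q hp hq)
  have hcorner : ∀ p q p' q', (p' = p - 1 ∨ p' = p) → (q' = q - 1 ∨ q' = q) →
      ((p : ℝ) / N, (q : ℝ) / N) ∈ gridCell N p' q' := fun p q p' q' hp' hq' =>
    mem_gridCell_of hN (cast_le_and_le_of_pred_or_eq hp').1 (cast_le_and_le_of_pred_or_eq hp').2
      (cast_le_and_le_of_pred_or_eq hq').1 (cast_le_and_le_of_pred_or_eq hq').2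
  have hvG : ∀ p q, p ≤ N → q ≤ N → v p q ∈ G p q := fun p q hp hq =>
    ⟨⟨⟨hΩxc _ _ _ (hcorner p q _ _ (Or.inl rfl) (Or.inl rfl)) (hvK p q hp hq),
       hΩxc _ _ _ (hcorner p q _ _ (Or.inl rfl) (Or.inr rfl)) (hvK p q hp hq)⟩,
      hΩxc _ _ _ (hcorner p q _ _ (Or.inr rfl) (Or.inl rfl)) (hvK p q hp hq)⟩,
     hΩxc _ _ _ (hcorner p q _ _ (Or.inr rfl) (Or.inr rfl)) (hvK p q hp hq)⟩
  haveI : Nonempty (Fin Z.n) := ⟨⟨0, Nat.pos_of_ne_zero (n_ne_zero_of_mem hZ hPZ)⟩⟩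
  have hvch : ∀ p q, p ≤ N ∧ q ≤ N → ∃ (i₀ : Fin Z.n) (ε : ℝ) (Ω : Set (Fin Z.n → ℂ))
      (ψ : ℂ → (Fin Z.n → ℂ)), 0 < ε ∧ IsOpen Ω ∧ v p q ∈ Ω ∧ Ω ⊆ G p q ∧
      AnalyticOnNhd ℂ ψ (ball (v p q i₀) ε) ∧
      (∀ z ∈ Ω, z ∈ Z.points → z i₀ ∈ ball (v p q i₀) ε ∧ ψ (z i₀) = z) ∧
      (∀ w ∈ ball (v p q i₀) ε, ψ w ∈ Ω ∧ ψ w ∈ Z.points ∧ ψ w i₀ = w) :=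
    fun p q hpq => exists_localChart_subset hZ (hvZ p q hpq.1 hpq.2) (hGo p q) (hvG p q hpq.1 hpq.2)
  choose! ιv εv Ωv ψv hεv hΩvo hvΩv hΩvG hψv h1v h2v using hvch
  ------------------------------------------------------------------
  -- Step 3: algebraic points `a p q` near the vertices (`P`, `Q` on the bottom and top rows)
  ------------------------------------------------------------------
  have hapt : ∀ p q, p ≤ N ∧ q ≤ N → ∃ a : Fin Z.n → ℂ,
      a ∈ Ωv p q ∩ (fun z : Fin Z.n → ℂ => z (ιv p q)) ⁻¹' ball (v p q (ιv p q)) (εv p q / 2) ∧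
      a ∈ Z.points ∧ ∀ i, IsAlgebraic ℚ (a i) := by
    intro p q hpq
    have hO : IsOpen (Ωv p q ∩
        (fun z : Fin Z.n → ℂ => z (ιv p q)) ⁻¹' ball (v p q (ιv p q)) (εv p q / 2)) :=
      (hΩvo p q hpq).inter (isOpen_ball.preimage (continuous_apply (ιv p q)))
    obtain ⟨a, haO, haZ, haa⟩ := hZ.exists_algebraicPoint_mem (hvZ p q hpq.1 hpq.2) hO
      ⟨hvΩv p q hpq, mem_ball_self (half_pos (hεv p q hpq))⟩
    exact ⟨a, haO, haZ, haa⟩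
  choose! apt haptO haptZ hapta using hapt
  let a : ℕ → ℕ → (Fin Z.n → ℂ) := fun p q => if q = 0 then P else if N ≤ q then Q else apt p q
  have ha_zero : ∀ p, a p 0 = P := fun p => if_pos rfl
  have ha_N : ∀ p q, q ≠ 0 → N ≤ q → a p q = Q := fun p q h0 hq => by
    show (if q = 0 then P else if N ≤ q then Q else apt p q) = Q
    rw [if_neg h0, if_pos hq]
  have ha_mid : ∀ p q, 0 < q → q < N → a p q = apt p q := fun p q h0 hq => by
    show (if q = 0 then P else if N ≤ q then Q else apt p q) = apt p q
    rw [if_neg (Nat.pos_iff_ne_zero.mp h0), if_neg (not_le.mpr hq)]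
  have hv0 : ∀ p, p ≤ N → v p 0 = P := fun p hp => by
    show H ((p : ℝ) / N, ((0 : ℕ) : ℝ) / N) = P
    rw [Nat.cast_zero, zero_div]
    exact hH0 _ (div_mem_Icc hN hp)
  have hvN : ∀ p, p ≤ N → v p N = Q := fun p hp => by
    show H ((p : ℝ) / N, (N : ℝ) / N) = Q
    rw [div_self hN'.ne']
    exact hH1 _ (div_mem_Icc hN hp)
  -- case analysis on `q`
  have hcases : ∀ q, q ≤ N → q = 0 ∨ (0 < q ∧ q < N) ∨ (q ≠ 0 ∧ N ≤ q ∧ q = N) := by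
    intro q hq
    rcases Nat.eq_zero_or_pos q with h0 | h0
    · exact Or.inl h0
    · rcases Nat.lt_or_ge q N with h1 | h1
      · exact Or.inr (Or.inl ⟨h0, h1⟩)
      · exact Or.inr (Or.inr ⟨by omega, h1, le_antisymm hq h1⟩)
  have haZ : ∀ p q, p ≤ N → q ≤ N → a p q ∈ Z.points := by
    intro p q hp hq
    rcases hcases q hq with h0 | ⟨h0, h1⟩ | ⟨h0, h1, _⟩
    · rw [h0, ha_zero]; exact hPZ
    · rw [ha_mid p q h0 h1]; exact haptZ p q ⟨hp, hq⟩
    · rw [ha_N p q h0 h1]; exact hQZ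
  have haa : ∀ p q, p ≤ N → q ≤ N → ∀ i, IsAlgebraic ℚ (a p q i) := by
    intro p q hp hq
    rcases hcases q hq with h0 | ⟨h0, h1⟩ | ⟨h0, h1, _⟩
    · rw [h0, ha_zero]; exact hPa
    · rw [ha_mid p q h0 h1]; exact hapta p q ⟨hp, hq⟩
    · rw [ha_N p q h0 h1]; exact hQa
  have haΩv : ∀ p q, p ≤ N → q ≤ N → a p q ∈ Ωv p q := by
    intro p q hp hq
    rcases hcases q hq with h0 | ⟨h0, h1⟩ | ⟨h0, h1, h2⟩
    · rw [h0, ha_zero, ← hv0 p hp]; exact hvΩv p 0 ⟨hp, Nat.zero_le N⟩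
    · rw [ha_mid p q h0 h1]; exact (haptO p q ⟨hp, hq⟩).1
    · rw [ha_N p q h0 h1, h2, ← hvN p hp]; exact hvΩv p N ⟨hp, le_rfl⟩
  have haball : ∀ p q, p ≤ N → q ≤ N → a p q (ιv p q) ∈ ball (v p q (ιv p q)) (εv p q / 2) := by
    intro p q hp hq
    rcases hcases q hq with h0 | ⟨h0, h1⟩ | ⟨h0, h1, h2⟩
    · rw [h0, ha_zero, ← hv0 p hp]; exact mem_ball_self (half_pos (hεv p 0 ⟨hp, Nat.zero_le N⟩))
    · rw [ha_mid p q h0 h1]; exact (haptO p q ⟨hp, hq⟩).2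
    · rw [ha_N p q h0 h1, h2, ← hvN p hp]; exact mem_ball_self (half_pos (hεv p N ⟨hp, le_rfl⟩))
  have hψa : ∀ p q, p ≤ N → q ≤ N → ψv p q (a p q (ιv p q)) = a p q := fun p q hp hq =>
    (h1v p q ⟨hp, hq⟩ _ (haΩv p q hp hq) (haZ p q hp hq)).2
  have hψvv : ∀ p q, p ≤ N → q ≤ N → ψv p q (v p q (ιv p q)) = v p q := fun p q hp hq =>
    (h1v p q ⟨hp, hq⟩ _ (hvΩv p q ⟨hp, hq⟩) (hvZ p q hp hq)).2
  ------------------------------------------------------------------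
  -- Step 4: move the side paths through the points `a 0 q`, `a N q`
  ------------------------------------------------------------------
  have hv0q : ∀ q, q ≤ N → v 0 q = γ₀.toFun ((q : ℝ) / N) := fun q hq => by
    show H (((0 : ℕ) : ℝ) / N, (q : ℝ) / N) = _
    rw [Nat.cast_zero, zero_div]
    exact (hγ₀ _ (div_mem_Icc hN hq)).symm
  have hvNq : ∀ q, q ≤ N → v N q = γ₁.toFun ((q : ℝ) / N) := fun q hq => by
    show H ((N : ℝ) / N, (q : ℝ) / N) = _
    rw [div_self hN'.ne']
    exact (hγ₁ _ (div_mem_Icc hN hq)).symm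
  have h0N : ∀ q, q < N → 0 ≤ N ∧ q ≤ N := fun q hq => ⟨Nat.zero_le N, hq.le⟩
  have hNN : ∀ q, q < N → N ≤ N ∧ q ≤ N := fun q hq => ⟨le_rfl, hq.le⟩
  obtain ⟨γ₀', hγ₀'a, hγ₀'0, hγ₀'1, hγ₀'v, hγ₀'sp⟩ := exists_adjust_grid hZ ω h γ₀ hN
    (fun q => ιv 0 q) (fun q => εv 0 q) (fun q => Ωv 0 q) (fun q => ψv 0 q)
    (fun q _ hqN => by rw [← hv0q q hqN.le]; exact hψv 0 q (h0N q hqN))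
    (fun q _ hqN => by rw [← hv0q q hqN.le]; exact h1v 0 q (h0N q hqN))
    (fun q _ hqN => by rw [← hv0q q hqN.le]; exact h2v 0 q (h0N q hqN))
    (fun q _ hqN => hΩvo 0 q (h0N q hqN))
    (fun q _ hqN => by rw [← hv0q q hqN.le]; exact hvΩv 0 q (h0N q hqN))
    (fun q => a 0 q) (fun q _ hqN => haZ 0 q (Nat.zero_le N) hqN.le)
    (fun q _ hqN => haΩv 0 q (Nat.zero_le N) hqN.le)
    (fun q _ hqN => by rw [← hv0q q hqN.le]; exact haball 0 q (Nat.zero_le N) hqN.le)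
  obtain ⟨γ₁', hγ₁'a, hγ₁'0, hγ₁'1, hγ₁'v, hγ₁'sp⟩ := exists_adjust_grid hZ ω h γ₁ hN
    (fun q => ιv N q) (fun q => εv N q) (fun q => Ωv N q) (fun q => ψv N q)
    (fun q _ hqN => by rw [← hvNq q hqN.le]; exact hψv N q (hNN q hqN))
    (fun q _ hqN => by rw [← hvNq q hqN.le]; exact h1v N q (hNN q hqN))
    (fun q _ hqN => by rw [← hvNq q hqN.le]; exact h2v N q (hNN q hqN))
    (fun q _ hqN => hΩvo N q (hNN q hqN))
    (fun q _ hqN => by rw [← hvNq q hqN.le]; exact hvΩv N q (hNN q hqN))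
    (fun q => a N q) (fun q _ hqN => haZ N q le_rfl hqN.le)
    (fun q _ hqN => haΩv N q le_rfl hqN.le)
    (fun q _ hqN => by rw [← hvNq q hqN.le]; exact haball N q le_rfl hqN.le)
  -- the values at the grid parameters are algebraic
  have halg₀ : ∀ q, q ≤ N → ∀ i, IsAlgebraic ℚ (γ₀'.toFun ((q : ℝ) / N) i) := by
    intro q hq i
    rcases hcases q hq with h0 | ⟨h0, h1⟩ | ⟨_, _, h2⟩
    · rw [h0, Nat.cast_zero, zero_div, hγ₀'0]; exact γ₀.algebraic_zero i
    · rw [hγ₀'a q h0 h1]; exact haa 0 q (Nat.zero_le N) hq i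
    · rw [h2, div_self hN'.ne', hγ₀'1]; exact γ₀.algebraic_one i
  have halg₁ : ∀ q, q ≤ N → ∀ i, IsAlgebraic ℚ (γ₁'.toFun ((q : ℝ) / N) i) := by
    intro q hq i
    rcases hcases q hq with h0 | ⟨h0, h1⟩ | ⟨_, _, h2⟩
    · rw [h0, Nat.cast_zero, zero_div, hγ₁'0]; exact γ₁.algebraic_zero i
    · rw [hγ₁'a q h0 h1]; exact haa N q le_rfl hq i
    · rw [h2, div_self hN'.ne', hγ₁'1]; exact γ₁.algebraic_one i
  ------------------------------------------------------------------
  -- Step 5: links `a p q → v p q` and the edge paths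
  ------------------------------------------------------------------
  have hlink : ∀ p q, p ≤ N ∧ q ≤ N → ∃ κ : ℝ → (Fin Z.n → ℂ), Continuous κ ∧ κ 0 = a p q ∧
      κ 1 = v p q ∧ (∀ t, κ t ∈ Z.points) ∧ ∀ t, κ t ∈ Ωv p q := fun p q hpq =>
    exists_vertexLink (hψv p q hpq) (h2v p q hpq)
      ((h1v p q hpq _ (haΩv p q hpq.1 hpq.2) (haZ p q hpq.1 hpq.2)).1)
      ((h1v p q hpq _ (hvΩv p q hpq) (hvZ p q hpq.1 hpq.2)).1) (hψa p q hpq.1 hpq.2)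
      (hψvv p q hpq.1 hpq.2)
  choose! κ hκc hκ0 hκ1 hκZ hκΩ using hlink
  haveI : Nonempty (CurvePath Z) := ⟨γ₀⟩
  -- horizontal edges `(p, q) → (p+1, q)`, `p < N`, `0 < q < N`, inside `Ωx p (q-1) ∩ Ωx p q`
  have hedge_h : ∀ p q, p < N ∧ 0 < q ∧ q < N → ∃ σ : CurvePath Z, σ.toFun 0 = a p q ∧
      σ.toFun 1 = a (p + 1) q ∧ ∀ t ∈ Icc (0 : ℝ) 1, σ.toFun t ∈ Ωx p (q - 1) ∩ Ωx p q := by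
    rintro p q ⟨hp, hq0, hqN⟩
    have hpq : p ≤ N ∧ q ≤ N := ⟨hp.le, hqN.le⟩
    have hpq' : p + 1 ≤ N ∧ q ≤ N := ⟨hp, hqN.le⟩
    -- the edge of `H`
    have heK : ∀ t : ℝ, (((p : ℝ) + clamp01 t) / N, (q : ℝ) / N) ∈ gridCell N p (q - 1) ∩ gridCell N p q :=
      fun t => ⟨mem_gridCell_of hN (by linarith [(clamp01_mem t).1]) (by linarith [(clamp01_mem t).2])
          (cast_le_and_le_of_pred_or_eq (Or.inl rfl)).1 (cast_le_and_le_of_pred_or_eq (Or.inl rfl)).2,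
        mem_gridCell_of hN (by linarith [(clamp01_mem t).1]) (by linarith [(clamp01_mem t).2])
          le_rfl (by linarith)⟩
    have heSq : ∀ t : ℝ, (((p : ℝ) + clamp01 t) / N, (q : ℝ) / N) ∈ Icc (0 : ℝ) 1 ×ˢ Icc (0 : ℝ) 1 :=
      fun t => gridCell_subset_square hN hp hqN (heK t).2
    have hec : Continuous fun t : ℝ => H (((p : ℝ) + clamp01 t) / N, (q : ℝ) / N) :=
      hH.comp_continuous (((continuous_const.add continuous_clamp01).div_const _).prodMk
        continuous_const) heSq
    refine exists_edgePath hZ ((hΩxo _ _).inter (hΩxo _ _)) (κ p q) (hκc p q hpq) (hκ0 p q hpq)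
      (hκ1 p q hpq) (hκZ p q hpq) (fun t => ⟨hG3 p q (hΩvG p q hpq (hκΩ p q hpq t)),
        hG4 p q (hΩvG p q hpq (hκΩ p q hpq t))⟩)
      (fun t : ℝ => H (((p : ℝ) + clamp01 t) / N, (q : ℝ) / N)) hec ?_ ?_
      (fun t _ => hHZ _ (heSq t)) (fun t _ => ⟨hΩxc _ _ _ (heK t).1 (heSq t), hΩxc _ _ _ (heK t).2 (heSq t)⟩)
      (κ (p + 1) q) (hκc _ _ hpq') (hκ0 _ _ hpq') (hκ1 _ _ hpq') (hκZ _ _ hpq') (fun t => ?_)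
      (haa p q hpq.1 hpq.2) (haa (p + 1) q hpq'.1 hpq'.2)
    · show H (((p : ℝ) + clamp01 0) / N, (q : ℝ) / N) = H ((p : ℝ) / N, (q : ℝ) / N)
      rw [clamp01_of_mem hI0, add_zero]
    · show H (((p : ℝ) + clamp01 1) / N, (q : ℝ) / N) = H ((((p + 1 : ℕ)) : ℝ) / N, (q : ℝ) / N)
      rw [clamp01_of_mem hI1]; push_cast; rfl
    · have h1 := hG1 (p + 1) q (hΩvG (p + 1) q hpq' (hκΩ _ _ hpq' t))
      have h2 := hG2 (p + 1) q (hΩvG (p + 1) q hpq' (hκΩ _ _ hpq' t))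
      rw [Nat.add_sub_cancel] at h1 h2
      exact ⟨h1, h2⟩
  choose! σh hσh0 hσh1 hσhG using hedge_h
  -- vertical edges `(p, q) → (p, q+1)`, `0 < p < N`, `q < N`, inside `Ωx (p-1) q ∩ Ωx p q`
  have hedge_v : ∀ p q, 0 < p ∧ p < N ∧ q < N → ∃ σ : CurvePath Z, σ.toFun 0 = a p q ∧
      σ.toFun 1 = a p (q + 1) ∧ ∀ t ∈ Icc (0 : ℝ) 1, σ.toFun t ∈ Ωx (p - 1) q ∩ Ωx p q := by
    rintro p q ⟨hp0, hpN, hq⟩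
    have hpq : p ≤ N ∧ q ≤ N := ⟨hpN.le, hq.le⟩
    have hpq' : p ≤ N ∧ q + 1 ≤ N := ⟨hpN.le, hq⟩
    have heK : ∀ t : ℝ, ((p : ℝ) / N, ((q : ℝ) + clamp01 t) / N) ∈ gridCell N (p - 1) q ∩ gridCell N p q :=
      fun t => ⟨mem_gridCell_of hN (cast_le_and_le_of_pred_or_eq (Or.inl rfl)).1
          (cast_le_and_le_of_pred_or_eq (Or.inl rfl)).2
          (by linarith [(clamp01_mem t).1]) (by linarith [(clamp01_mem t).2]),
        mem_gridCell_of hN le_rfl (by linarith) (by linarith [(clamp01_mem t).1])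
          (by linarith [(clamp01_mem t).2])⟩
    have heSq : ∀ t : ℝ, ((p : ℝ) / N, ((q : ℝ) + clamp01 t) / N) ∈ Icc (0 : ℝ) 1 ×ˢ Icc (0 : ℝ) 1 :=
      fun t => gridCell_subset_square hN hpN hq (heK t).2
    have hec : Continuous fun t : ℝ => H ((p : ℝ) / N, ((q : ℝ) + clamp01 t) / N) :=
      hH.comp_continuous (continuous_const.prodMk
        ((continuous_const.add continuous_clamp01).div_const _)) heSq
    refine exists_edgePath hZ ((hΩxo _ _).inter (hΩxo _ _)) (κ p q) (hκc p q hpq) (hκ0 p q hpq)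
      (hκ1 p q hpq) (hκZ p q hpq) (fun t => ⟨hG2 p q (hΩvG p q hpq (hκΩ p q hpq t)),
        hG4 p q (hΩvG p q hpq (hκΩ p q hpq t))⟩)
      (fun t : ℝ => H ((p : ℝ) / N, ((q : ℝ) + clamp01 t) / N)) hec ?_ ?_
      (fun t _ => hHZ _ (heSq t)) (fun t _ => ⟨hΩxc _ _ _ (heK t).1 (heSq t), hΩxc _ _ _ (heK t).2 (heSq t)⟩)
      (κ p (q + 1)) (hκc _ _ hpq') (hκ0 _ _ hpq') (hκ1 _ _ hpq') (hκZ _ _ hpq') (fun t => ?_)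
      (haa p q hpq.1 hpq.2) (haa p (q + 1) hpq'.1 hpq'.2)
    · show H ((p : ℝ) / N, ((q : ℝ) + clamp01 0) / N) = H ((p : ℝ) / N, (q : ℝ) / N)
      rw [clamp01_of_mem hI0, add_zero]
    · show H ((p : ℝ) / N, ((q : ℝ) + clamp01 1) / N) = H ((p : ℝ) / N, (((q + 1 : ℕ)) : ℝ) / N)
      rw [clamp01_of_mem hI1]; push_cast; rfl
    · have h1 := hG1 p (q + 1) (hΩvG p (q + 1) hpq' (hκΩ _ _ hpq' t))
      have h3 := hG3 p (q + 1) (hΩvG p (q + 1) hpq' (hκΩ _ _ hpq' t))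
      rw [Nat.add_sub_cancel] at h1 h3
      exact ⟨h1, h3⟩
  choose! σv hσv0 hσv1 hσvG using hedge_v
  ------------------------------------------------------------------
  -- Step 6: the edge families of the grid
  ------------------------------------------------------------------
  let cP : CurvePath Z := CurvePath.const P hPZ hPa
  let cQ : CurvePath Z := CurvePath.const Q hQZ hQa
  let eh : ℕ → ℕ → CurvePath Z := fun p q => if q = 0 then cP else if N ≤ q then cQ else σh p q
  let ev : ℕ → ℕ → CurvePath Z := fun p q =>
    if p = 0 then γ₀'.gridPiece N hN halg₀ q else if N ≤ p then γ₁'.gridPiece N hN halg₁ q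
      else σv p q
  have heh_zero : ∀ p, eh p 0 = cP := fun p => if_pos rfl
  have heh_N : ∀ p q, q ≠ 0 → N ≤ q → eh p q = cQ := fun p q h0 hq => by
    show (if q = 0 then cP else if N ≤ q then cQ else σh p q) = cQ
    rw [if_neg h0, if_pos hq]
  have heh_mid : ∀ p q, 0 < q → q < N → eh p q = σh p q := fun p q h0 hq => by
    show (if q = 0 then cP else if N ≤ q then cQ else σh p q) = σh p q
    rw [if_neg (Nat.pos_iff_ne_zero.mp h0), if_neg (not_le.mpr hq)]
  have hev_zero : ∀ q, ev 0 q = γ₀'.gridPiece N hN halg₀ q := fun q => if_pos rfl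
  have hev_N : ∀ q, ev N q = γ₁'.gridPiece N hN halg₁ q := fun q => by
    show (if N = 0 then γ₀'.gridPiece N hN halg₀ q else
      if N ≤ N then γ₁'.gridPiece N hN halg₁ q else σv N q) = _
    rw [if_neg hN.ne', if_pos le_rfl]
  have hev_mid : ∀ p q, 0 < p → p < N → ev p q = σv p q := fun p q h0 hp => by
    show (if p = 0 then γ₀'.gridPiece N hN halg₀ q else
      if N ≤ p then γ₁'.gridPiece N hN halg₁ q else σv p q) = σv p q
    rw [if_neg (Nat.pos_iff_ne_zero.mp h0), if_neg (not_le.mpr hp)]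
  ------------------------------------------------------------------
  -- Step 7: the hypotheses of the grid assembly
  ------------------------------------------------------------------
  have Heh0 : ∀ p q, p < N → q ≤ N → (eh p q).toFun 0 = a p q := by
    intro p q hp hq
    rcases hcases q hq with h0 | ⟨h0, h1⟩ | ⟨h0, h1, _⟩
    · rw [h0, heh_zero, ha_zero]; rfl
    · rw [heh_mid p q h0 h1]; exact hσh0 p q ⟨hp, h0, h1⟩
    · rw [heh_N p q h0 h1, ha_N p q h0 h1]; rfl
  have Heh1 : ∀ p q, p < N → q ≤ N → (eh p q).toFun 1 = a (p + 1) q := by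
    intro p q hp hq
    rcases hcases q hq with h0 | ⟨h0, h1⟩ | ⟨h0, h1, _⟩
    · rw [h0, heh_zero, ha_zero]; rfl
    · rw [heh_mid p q h0 h1]; exact hσh1 p q ⟨hp, h0, h1⟩
    · rw [heh_N p q h0 h1, ha_N (p + 1) q h0 h1]; rfl
  have hcast1 : ∀ q : ℕ, (q : ℝ) / N + 1 / N = ((q + 1 : ℕ) : ℝ) / N := fun q => by
    push_cast; ring
  have Hev0 : ∀ p q, p ≤ N → q < N → (ev p q).toFun 0 = a p q := by
    intro p q hp hq
    rcases hcases p hp with h0 | ⟨h0, h1⟩ | ⟨_, _, h2⟩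
    · rw [h0, hev_zero, CurvePath.gridPiece_apply _ _ _ _ hq, zero_div, add_zero]
      rcases Nat.eq_zero_or_pos q with hq0 | hq0
      · rw [hq0, Nat.cast_zero, zero_div, hγ₀'0, hP0, ha_zero]
      · rw [hγ₀'a q hq0 hq]
    · rw [hev_mid p q h0 h1]; exact hσv0 p q ⟨h0, h1, hq⟩
    · rw [h2, hev_N, CurvePath.gridPiece_apply _ _ _ _ hq, zero_div, add_zero]
      rcases Nat.eq_zero_or_pos q with hq0 | hq0
      · rw [hq0, Nat.cast_zero, zero_div, hγ₁'0, hP1, ha_zero]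
      · rw [hγ₁'a q hq0 hq]
  have Hev1 : ∀ p q, p ≤ N → q < N → (ev p q).toFun 1 = a p (q + 1) := by
    intro p q hp hq
    rcases hcases p hp with h0 | ⟨h0, h1⟩ | ⟨_, _, h2⟩
    · rw [h0, hev_zero, CurvePath.gridPiece_apply _ _ _ _ hq, hcast1]
      rcases Nat.lt_or_ge (q + 1) N with hq1 | hq1
      · rw [hγ₀'a (q + 1) (Nat.succ_pos q) hq1]
      · have hqN : q + 1 = N := le_antisymm hq hq1
        rw [hqN, div_self hN'.ne', hγ₀'1, hQ0, ha_N 0 N hN.ne' le_rfl]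
    · rw [hev_mid p q h0 h1]; exact hσv1 p q ⟨h0, h1, hq⟩
    · rw [h2, hev_N, CurvePath.gridPiece_apply _ _ _ _ hq, hcast1]
      rcases Nat.lt_or_ge (q + 1) N with hq1 | hq1
      · rw [hγ₁'a (q + 1) (Nat.succ_pos q) hq1]
      · have hqN : q + 1 = N := le_antisymm hq hq1
        rw [hqN, div_self hN'.ne', hγ₁'1, hQ1, ha_N N N hN.ne' le_rfl]
  have Hb : ∀ p q, p < N → q < N → ∀ t ∈ Icc (0 : ℝ) 1, (eh p q).toFun t ∈ Ωc p q := by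
    intro p q hp hq t ht
    rcases Nat.eq_zero_or_pos q with h0 | h0
    · rw [h0, heh_zero, ← hΩx_eq p 0 hp (h0 ▸ hq)]
      show P ∈ Ωx p 0
      rw [← hv0 p hp.le]
      exact hΩxc p 0 _ (hcorner p 0 p 0 (Or.inr rfl) (Or.inr rfl)) (hvK p 0 hp.le (Nat.zero_le N))
    · rw [heh_mid p q h0 hq, ← hΩx_eq p q hp hq]; exact (hσhG p q ⟨hp, h0, hq⟩ t ht).2
  have Ht : ∀ p q, p < N → q < N → ∀ t ∈ Icc (0 : ℝ) 1, (eh p (q + 1)).toFun t ∈ Ωc p q := by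
    intro p q hp hq t ht
    rcases Nat.lt_or_ge (q + 1) N with hq1 | hq1
    · rw [heh_mid p (q + 1) (Nat.succ_pos q) hq1, ← hΩx_eq p q hp hq]
      have := (hσhG p (q + 1) ⟨hp, Nat.succ_pos q, hq1⟩ t ht).1
      rwa [Nat.add_sub_cancel] at this
    · rw [heh_N p (q + 1) (Nat.succ_ne_zero q) hq1, ← hΩx_eq p q hp hq]
      show Q ∈ Ωx p q
      have hqN : q = N - 1 := by omega
      rw [← hvN p hp.le, hqN]
      exact hΩxc p (N - 1) _ (hcorner p N p (N - 1) (Or.inr rfl) (Or.inl rfl)) (hvK p N hp.le le_rfl)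
  have Hl : ∀ p q, p < N → q < N → ∀ t ∈ Icc (0 : ℝ) 1, (ev p q).toFun t ∈ Ωc p q := by
    intro p q hp hq t ht
    rcases Nat.eq_zero_or_pos p with h0 | h0
    · subst h0
      rw [hev_zero]
      refine gridPiece_mem_of_adjusted hN halg₀ (fun q => Ωv 0 q) hγ₀'v hq (fun u hu => ?_)
        (fun _ z hz => ?_) (fun hq1 z hz => ?_) t ht
      · have huI : u ∈ Icc (0 : ℝ) 1 := ⟨le_trans (by positivity) hu.1,
          hu.2.trans ((div_le_one hN').mpr (by exact_mod_cast hq))⟩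
        rw [hγ₀ u huI, ← hΩx_eq 0 q hp hq]
        refine hΩxc 0 q _ ⟨⟨?_, ?_⟩, hu⟩ ⟨hI0, huI⟩
        · rw [Nat.cast_zero, zero_div]
        · positivity
      · rw [← hΩx_eq 0 q hp hq]; exact hG4 0 q (hΩvG 0 q ⟨Nat.zero_le N, hq.le⟩ hz)
      · rw [← hΩx_eq 0 q hp hq]
        have := hG3 0 (q + 1) (hΩvG 0 (q + 1) ⟨Nat.zero_le N, hq1.le⟩ hz)
        rwa [Nat.add_sub_cancel] at this
    · rw [hev_mid p q h0 hp, ← hΩx_eq p q hp hq]; exact (hσvG p q ⟨h0, hp, hq⟩ t ht).2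
  have Hr : ∀ p q, p < N → q < N → ∀ t ∈ Icc (0 : ℝ) 1, (ev (p + 1) q).toFun t ∈ Ωc p q := by
    intro p q hp hq t ht
    rcases Nat.lt_or_ge (p + 1) N with hp1 | hp1
    · rw [hev_mid (p + 1) q (Nat.succ_pos p) hp1, ← hΩx_eq p q hp hq]
      have := (hσvG (p + 1) q ⟨Nat.succ_pos p, hp1, hq⟩ t ht).1
      rwa [Nat.add_sub_cancel] at this
    · have hpN : p + 1 = N := le_antisymm hp hp1
      have hpN' : p = N - 1 := by omega
      rw [hpN, hev_N]
      refine gridPiece_mem_of_adjusted hN halg₁ (fun q => Ωv N q) hγ₁'v hq (fun u hu => ?_)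
        (fun _ z hz => ?_) (fun hq1 z hz => ?_) t ht
      · have huI : u ∈ Icc (0 : ℝ) 1 := ⟨le_trans (by positivity) hu.1,
          hu.2.trans ((div_le_one hN').mpr (by exact_mod_cast hq))⟩
        rw [hγ₁ u huI, ← hΩx_eq p q hp hq]
        refine hΩxc p q _ ⟨⟨?_, ?_⟩, hu⟩ ⟨hI1, huI⟩
        · rw [div_le_one hN']; exact_mod_cast hp.le
        · rw [← Nat.cast_add_one, hpN, div_self hN'.ne']
      · rw [← hΩx_eq p q hp hq, hpN']; exact hG2 N q (hΩvG N q ⟨le_rfl, hq.le⟩ hz)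
      · rw [← hΩx_eq p q hp hq, hpN']
        have := hG1 N (q + 1) (hΩvG N (q + 1) ⟨le_rfl, hq1.le⟩ hz)
        rwa [Nat.add_sub_cancel] at this
  have Hbot : ∀ p, p < N → InSpan (Finsupp.single (⟨Z, hZ, ω, h, eh p 0⟩ : PeriodSymbol) (1 : ℂ)) :=
    fun p _ => by
      rw [heh_zero]
      exact span_of_rel (isElementaryRelation_single_of_const hZ ω h cP P fun _ _ => rfl)
  have Htop : ∀ p, p < N → InSpan (Finsupp.single (⟨Z, hZ, ω, h, eh p N⟩ : PeriodSymbol) (1 : ℂ)) :=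
    fun p _ => by
      rw [heh_N p N hN.ne' le_rfl]
      exact span_of_rel (isElementaryRelation_single_of_const hZ ω h cQ Q fun _ _ => rfl)
  ------------------------------------------------------------------
  -- Step 8: assemble
  ------------------------------------------------------------------
  have hsides := span_grid_sides hZ ω h N ι cc εc Ωc ψc (fun p q hp hq => (hcell p q hp hq).2.1)
    (fun p q hp hq => (hcell p q hp hq).2.2.1) (fun p q hp hq => (hcell p q hp hq).2.2.2.1) a eh ev
    Heh0 Heh1 Hev0 Hev1 Hb Ht Hl Hr Hbot Htop
  simp only [hev_N, hev_zero] at hsides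
  have hp₀ := span_single_sub_sum_gridPiece γ₀' N hN halg₀ hZ ω h
  have hp₁ := span_single_sub_sum_gridPiece γ₁' N hN halg₁ hZ ω h
  obtain ⟨k, ρ, c, hρ, hc, he⟩ :=
    span_sub (span_sub (span_add hγ₀'sp hp₀) (span_add hγ₁'sp hp₁)) hsides
  exact ⟨k, ρ, c, hρ, hc, by rw [← he]; abel⟩

end CurvePeriods

end Literature.NumberTheory.Transcendental

end
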